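import Literature.AlgebraicGeometry.Resolution.CentreBlowupAdaptedOrder
import Literature.AlgebraicGeometry.Resolution.PointBlowupKangaroo
import Mathlib.Algebra.MvPolynomial.PDeriv
import HarnessLib

/-!
# [Cossart–Piltant 2019, Example 3.1]: the permissible curve of the second kind, computed in the model

`CentreBlowupAdaptedOrder` types Cossart–Piltant's `ε(x)`, `ω(x)`, `ε(y)` and the centre predicates
(Hironaka-permissible, first / second kind, clause (iii) of Def. 3.2) at a coordinate centre `C_S`, and
`CentreBlowupRemark32` computes the published example in which clause (iii) FAILS.  This file computes
the paper's POSITIVE example of Def. 3.2, [Cossart–Piltant 2019, Example 3.1 (p. 32)], for every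
exponent `p > 1` (where needed) over any field `K`:

"Example 3.1. Let `k` be a perfect field of characteristic `p > 0`, `A := k[u₁,u₂,u₃]`,
`P ∈ k[x] ∖ k[x^p]` and take `h := Z^p + P(u₃)u₂^p + u₁^{p+1} ∈ A[Z]`, `E := div(u₁)`.
Let `𝒴 := V(Z,u₁,u₂) ⊆ Sing_p 𝒳` with generic point `y`. […] For `x ∈ 𝒰`, there exist well adapted
coordinates `(u₁,u₂,v_x; Z_x := Z − γ_x u₂)` at `x` […] such that `h = Z_x^p + v_x u₂^p + u₁^{p+1}`.
Then `𝒴` is permissible of the second kind at every `x ∈ 𝒰` since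
`J̄(F_{p,Z_x,W},E,W) = ∂F_{p,Z_x,W}/∂v̄_x = U₂^p ≠ 0`, `F_{p,Z_x,W} = v̄_x U₂^p ∈ G(W)_p`
with notations as in definition 3.2 (iii)."  (The example "constructs a threefold `𝒳` such that every
resolution of singularities `𝒳̃ → 𝒳` which is a composition of Hironaka-permissible blowing ups does
actually involve blowing up a permissible curve of the second kind.")

Dictionary: variables `0,1,2` are `u₁,u₂,v` (the local coordinates at `x ∈ 𝒰`);
`F = h − Z^p = v u₂^p + u₁^{p+1} = y^{d_A} + y^{d_B}`, `d_A = e₂ + p·e₁ = Finsupp.single 2 1 + Finsupp.single 1 p`,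
`d_B = (p+1)·e₀ = Finsupp.single 0 (p+1)`; `exc = {0}` (`E = div(u₁)`); the centre `𝒴 = V(Z,u₁,u₂)` is
`S = cp19Example31Centre = {0,1}`; no new definition besides the state and the centre.

* §1 the state `x`: `ord₀ F = p + 1`, `H_j = 0`, `ε(x) = p + 1`, `F_{p,Z} = F`, "`∂F/∂v̄ = U₂^p ≠ 0`"
  with `v ∉ E`, so `V ≠ 0` and `ω(x) = p`;
* §2 the centre `𝒴`: `ord_{C_S} F = p` (`𝒴 ⊆ Sing_p 𝒳`: Hironaka-permissible), `ε(y) = p = ε(x) − 1`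
  (clause (ii)), clause (iii) holds with the monomial `v u₂^p` (`div(v) ⊄ E`): `𝒴` IS permissible of
  the second kind (and not of the first kind) — the typed predicate `IsSecondKind` accepts the paper's
  example, where it rejects the centre `𝒴₁` of Remark 3.2;
* §3 the blow-up of `𝒴` (the model's two charts `u₁`, `u₂`, every point `b` of the fibre over `x`):
  the transform has a monomial of degree `1` with coefficient `1` (`u'₁` in the `u₁`-chart, `v` in the
  `u₂`-chart), so `ord₀ F' = 1 < p`: NO point of `π⁻¹(x)` is again `p`-fold ("`m(x') ≤ m(x) = p` in any
  case", proof of Thm. 3.6, here strictly) — blowing up the second-kind curve lowers the multiplicity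
  everywhere over `x`; consequently the row-wise test predicates `NoOmegaIncreaseAtCentre` and
  `EpsilonIncreaseForcesFirstKindAt` of `CentreBlowupAdaptedOrder` hold at every `(j, b)`.

Only the local form at `x ∈ 𝒰` is modelled (the model has no `P(u₃)`, no `γ_x`); nothing is asserted
about `κ(x) = 2`, Prop. 3.3, or the global statement that second-kind blow-ups are unavoidable.
AI-assisted formalisation (observatory `pub-rosobs`, unit `pub-rosobs-carver-g25`); quotations from
arXiv:1412.0868 (PDF page 32; Thm. 3.6 on p. 35).
-/

noncomputable section

open MvPolynomial Finset

open scoped BigOperators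

namespace Literature.AlgebraicGeometry.Resolution

open Literature.AlgebraicGeometry.Resolution.Hauser2010
open Literature.AlgebraicGeometry.Resolution.HauserPerlega2019 (initialForm)

namespace CentreBlowup

/-! ### 0. Private helpers -/

section Helpers

variable {σ : Type*} {K : Type*}

/-- The `C_S`-chart transform of `y^{d₁} + y^{d₂}` (`d₁ ≠ d₂`). [folklore] -/
private theorem chartTransform_binomial' [DecidableEq σ] [Field K] (q : ℕ) (S : Finset σ) (j : σ)
    {d₁ d₂ : σ →₀ ℕ} (h : d₁ ≠ d₂) :
    chartTransform q S j (monomial d₁ (1 : K) + monomial d₂ 1) =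
      monomial (chartExponent q S j d₁) 1 + monomial (chartExponent q S j d₂) 1 := by
  unfold chartTransform
  rw [PointBlowup.support_binomial h, Finset.sum_pair h, coeff_add, coeff_add, coeff_monomial,
    coeff_monomial, coeff_monomial, coeff_monomial, if_pos rfl, if_pos rfl, if_neg h,
    if_neg (Ne.symm h), add_zero, zero_add]

/-- `H_j ≤ d_j` for every monomial `y^d` of `F`. [folklore] -/
private theorem bigH_le_apply' [CommRing K] {F : MvPolynomial σ K} {d : σ →₀ ℕ} (hd : d ∈ F.support)
    (j : σ) : PointBlowup.bigH F j ≤ d j :=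
  Finset.inf_le (f := fun d : σ →₀ ℕ => ((d j : ℕ) : ℕ∞)) hd

/-- The cleaned transform of a `C_S`-step has no constant term (the exponent `0` is a `q`-th power
exponent). [folklore] -/
private theorem coeff_zero_step_F [DecidableEq σ] [Field K] [DecidableEq K] (q : ℕ) (S : Finset σ)
    (j : σ) (b : σ → K) (s : CState σ K) : coeff 0 (step q S j b s).F = 0 := by
  show coeff 0 (deletePthPowers q (pointTransform q S j b s)) = 0
  rw [coeff_deletePthPowers, if_pos ((isPthPowerExponent_iff q 0).mpr fun i => by simp)]

/-- A cleaned transform with a nonzero coefficient in degree `1` has order `1`. [folklore] -/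
private theorem ordZero_step_F_eq_one [DecidableEq σ] [Field K] [DecidableEq K] (q : ℕ)
    (S : Finset σ) (j : σ) (b : σ → K) (s : CState σ K) (i : σ)
    (h : coeff (Finsupp.single i 1) (step q S j b s).F ≠ 0) : ordZero (step q S j b s).F = (1 : ℕ) := by
  refine (ordZero_eq_nat_iff _ 1).mpr ⟨⟨Finsupp.single i 1, h, Finsupp.degree_single _ _⟩, ?_⟩
  intro d hd
  rw [(Finsupp.degree_eq_zero_iff d).mp (Nat.lt_one_iff.mp hd)]
  exact coeff_zero_step_F q S j b s

end Helpers

/-! ### 1. The state at `x ∈ 𝒰`: `h = Z^p + v u₂^p + u₁^{p+1}`, `E = div(u₁)` -/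

section Example

variable {K : Type*} [Field K]

/-- [CP19, Example 3.1] at a point `x ∈ 𝒰`: "`h = Z_x^p + v_x u₂^p + u₁^{p+1}`", "`E := div(u₁)`"
(variables `0,1,2` for `u₁,u₂,v_x`; `r = 0`). [cite: CossartPiltant2019, Example 3.1 (p. 32)] -/
def cp19Example31 (p : ℕ) : CState (Fin 3) K where
  F := X 2 * X 1 ^ p + X 0 ^ (p + 1)
  r := 0
  exc := {0}

/-- The curve "`𝒴 := V(Z,u₁,u₂) ⊆ Sing_p 𝒳`" of Example 3.1: `S = {u₁,u₂}`.
[cite: CossartPiltant2019, Example 3.1 (p. 32)] -/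
def cp19Example31Centre : Finset (Fin 3) := {0, 1}

/-- `(d_A)_{u₁} = 0`. [cite: CossartPiltant2019, Example 3.1 (p. 32)] -/
theorem cp19Example31ExpA_zero (p : ℕ) :
    (Finsupp.single 2 1 + Finsupp.single 1 p : Fin 3 →₀ ℕ) 0 = 0 := by
  simp

/-- `(d_A)_{u₂} = p`. [cite: CossartPiltant2019, Example 3.1 (p. 32)] -/
theorem cp19Example31ExpA_one (p : ℕ) :
    (Finsupp.single 2 1 + Finsupp.single 1 p : Fin 3 →₀ ℕ) 1 = p := by
  simp

/-- `(d_A)_{v} = 1`. [cite: CossartPiltant2019, Example 3.1 (p. 32)] -/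
theorem cp19Example31ExpA_two (p : ℕ) :
    (Finsupp.single 2 1 + Finsupp.single 1 p : Fin 3 →₀ ℕ) 2 = 1 := by
  simp

/-- `(d_B)_{u₁} = p + 1`. [cite: CossartPiltant2019, Example 3.1 (p. 32)] -/
theorem cp19Example31ExpB_zero (p : ℕ) : (Finsupp.single 0 (p + 1) : Fin 3 →₀ ℕ) 0 = p + 1 := by
  simp

/-- `(d_B)_{u₂} = 0`. [cite: CossartPiltant2019, Example 3.1 (p. 32)] -/
theorem cp19Example31ExpB_one (p : ℕ) : (Finsupp.single 0 (p + 1) : Fin 3 →₀ ℕ) 1 = 0 := by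
  simp

/-- `(d_B)_{v} = 0`. [cite: CossartPiltant2019, Example 3.1 (p. 32)] -/
theorem cp19Example31ExpB_two (p : ℕ) : (Finsupp.single 0 (p + 1) : Fin 3 →₀ ℕ) 2 = 0 := by
  simp

/-- `d_A ≠ d_B`. [cite: CossartPiltant2019, Example 3.1 (p. 32)] -/
theorem cp19Example31ExpA_ne_ExpB (p : ℕ) :
    (Finsupp.single 2 1 + Finsupp.single 1 p : Fin 3 →₀ ℕ) ≠ Finsupp.single 0 (p + 1) := by
  intro h
  have h2 := DFunLike.congr_fun h 2
  rw [cp19Example31ExpA_two, cp19Example31ExpB_two] at h2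
  exact one_ne_zero h2

/-- `|d_A| = p + 1`. [cite: CossartPiltant2019, Example 3.1 (p. 32)] -/
theorem degree_cp19Example31ExpA (p : ℕ) :
    (Finsupp.single 2 1 + Finsupp.single 1 p : Fin 3 →₀ ℕ).degree = p + 1 := by
  rw [map_add, Finsupp.degree_single, Finsupp.degree_single, add_comm]

/-- `F = h − Z^p = v u₂^p + u₁^{p+1} = y^{d_A} + y^{d_B}`. [cite: CossartPiltant2019, Example 3.1 (p. 32)] -/
theorem cp19Example31_F (p : ℕ) :
    (cp19Example31 p : CState (Fin 3) K).F =
      monomial (Finsupp.single 2 1 + Finsupp.single 1 p) 1 + monomial (Finsupp.single 0 (p + 1)) 1 := by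
  show (X 2 * X 1 ^ p + X 0 ^ (p + 1) : MvPolynomial (Fin 3) K) = _
  have h2 : (X 2 : MvPolynomial (Fin 3) K) = monomial (Finsupp.single 2 1) 1 := rfl
  rw [h2, X_pow_eq_monomial, X_pow_eq_monomial, monomial_mul, mul_one]

/-- `supp F = {d_A, d_B}`. [cite: CossartPiltant2019, Example 3.1 (p. 32)] -/
theorem cp19Example31_support (p : ℕ) :
    (cp19Example31 p : CState (Fin 3) K).F.support =
      {Finsupp.single 2 1 + Finsupp.single 1 p, Finsupp.single 0 (p + 1)} := by
  rw [cp19Example31_F, PointBlowup.support_binomial (cp19Example31ExpA_ne_ExpB p)]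

/-- `ord₀ F = p + 1`. [cite: CossartPiltant2019, Example 3.1 (p. 32)] -/
theorem cp19Example31_ordZero (p : ℕ) :
    ordZero (cp19Example31 p : CState (Fin 3) K).F = (p + 1 : ℕ) := by
  rw [cp19Example31_F, PointBlowup.ordZero_binomial (cp19Example31ExpA_ne_ExpB p)
    ((Finsupp.degree_single _ _).trans_le (degree_cp19Example31ExpA p).ge), Finsupp.degree_single]

/-- `H_j = 0` for every `j` (`E = div(u₁)`, `u₁ ∤ F`). [cite: CossartPiltant2019, Example 3.1 (p. 32)] -/
theorem cp19Example31_bigH (p : ℕ) (j : Fin 3) :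
    PointBlowup.bigH (cp19Example31 p : CState (Fin 3) K).F j = 0 := by
  have hj : j = 0 ∨ (j = 1 ∨ j = 2) := by revert j; decide
  have hA : (Finsupp.single 2 1 + Finsupp.single 1 p : Fin 3 →₀ ℕ) ∈
      (cp19Example31 p : CState (Fin 3) K).F.support := by
    rw [cp19Example31_support]; exact Finset.mem_insert_self _ _
  have hB : (Finsupp.single 0 (p + 1) : Fin 3 →₀ ℕ) ∈
      (cp19Example31 p : CState (Fin 3) K).F.support := by
    rw [cp19Example31_support]; exact Finset.mem_insert_of_mem (Finset.mem_singleton_self _)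
  have hA' := bigH_le_apply' hA j
  have hB' := bigH_le_apply' hB j
  rcases hj with rfl | (rfl | rfl)
  · rw [cp19Example31ExpA_zero, Nat.cast_zero] at hA'; exact nonpos_iff_eq_zero.mp hA'
  · rw [cp19Example31ExpB_one, Nat.cast_zero] at hB'; exact nonpos_iff_eq_zero.mp hB'
  · rw [cp19Example31ExpB_two, Nat.cast_zero] at hB'; exact nonpos_iff_eq_zero.mp hB'

/-- `ε(x) = p + 1`. [cite: CossartPiltant2019, Example 3.1 (p. 32) with Def. 2.9 (p. 15)] -/
theorem cp19Example31_epsilon (p : ℕ) :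
    (cp19Example31 p : CState (Fin 3) K).epsilon = (p + 1 : ℕ) := by
  rw [CState.epsilon_eq, Finset.sum_eq_zero (fun j _ => cp19Example31_bigH p j), tsub_zero,
    cp19Example31_ordZero]

/-- `F` is a form of degree `p + 1` ("`F_{p,Z_x,W} = v̄_x U₂^p ∈ G(W)_p`").
[cite: CossartPiltant2019, Example 3.1 (p. 32)] -/
theorem cp19Example31_isHomogeneous (p : ℕ) :
    ((cp19Example31 p : CState (Fin 3) K).F).IsHomogeneous (p + 1) := by
  rw [cp19Example31_F]
  exact (isHomogeneous_monomial _ (degree_cp19Example31ExpA p)).add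
    (isHomogeneous_monomial _ (Finsupp.degree_single _ _))

/-- `F_{p,Z} = F`. [cite: CossartPiltant2019, Example 3.1 (p. 32)] -/
theorem cp19Example31_initialForm (p : ℕ) :
    initialForm (cp19Example31 p : CState (Fin 3) K).F = (cp19Example31 p : CState (Fin 3) K).F := by
  unfold HauserPerlega2019.initialForm
  rw [cp19Example31_ordZero, ENat.toNat_coe]
  exact homogeneousComponent_eq_self (cp19Example31_isHomogeneous p)

/-- "`J̄(F_{p,Z_x,W},E,W) = ∂F_{p,Z_x,W}/∂v̄_x = U₂^p`": `∂F_{p,Z}/∂v = u₂^p`.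
[cite: CossartPiltant2019, Example 3.1 (p. 32)] -/
theorem cp19Example31_pderiv (p : ℕ) :
    pderiv 2 (initialForm (cp19Example31 p : CState (Fin 3) K).F) = X 1 ^ p := by
  have hA : (Finsupp.single 2 1 + Finsupp.single 1 p : Fin 3 →₀ ℕ) - Finsupp.single 2 1 =
      Finsupp.single 1 p := add_tsub_cancel_left _ _
  rw [cp19Example31_initialForm, cp19Example31_F, map_add, pderiv_monomial, pderiv_monomial,
    cp19Example31ExpA_two, cp19Example31ExpB_two, Nat.cast_one, mul_one, Nat.cast_zero, mul_zero,
    monomial_zero, add_zero, hA, X_pow_eq_monomial]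

/-- "`U₂^p ≠ 0`". [cite: CossartPiltant2019, Example 3.1 (p. 32)] -/
theorem cp19Example31_pderiv_ne_zero (p : ℕ) :
    pderiv 2 (initialForm (cp19Example31 p : CState (Fin 3) K).F) ≠ 0 := by
  rw [cp19Example31_pderiv, X_pow_eq_monomial, Ne, monomial_eq_zero]
  exact one_ne_zero

/-- `V(F_{p,Z},E,m_S) ≠ 0`: `v ∉ E` and `∂F_{p,Z}/∂v ≠ 0`. [cite: CossartPiltant2019, Example 3.1 (p. 32) with Def. 2.16 (p. 24)] -/
theorem cp19Example31_vNonzero (p : ℕ) :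
    PointBlowup.VNonzero (cp19Example31 p : CState (Fin 3) K).exc (cp19Example31 p : CState (Fin 3) K).F :=
  ⟨2, (show (2 : Fin 3) ∉ ({0} : Finset (Fin 3)) by decide), cp19Example31_pderiv_ne_zero p⟩

/-- `ω(x) = p`. [cite: CossartPiltant2019, Example 3.1 (p. 32) with Def. 2.16 (p. 24)] -/
theorem cp19Example31_omega (p : ℕ) : (cp19Example31 p : CState (Fin 3) K).omega = p := by
  rw [CState.omega_eq_of_vNonzero _ (cp19Example31_vNonzero p), cp19Example31_epsilon, ← ENat.coe_one,
    ← ENat.coe_sub, Nat.add_sub_cancel]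

/-- `ω(x) > 0` for `p > 0` (hypothesis of Thm. 3.6). [cite: CossartPiltant2019, Example 3.1 (p. 32)] -/
theorem cp19Example31_omega_pos {p : ℕ} (hp : 0 < p) : 0 < (cp19Example31 p : CState (Fin 3) K).omega := by
  rw [cp19Example31_omega]
  exact_mod_cast hp

/-! ### 2. The curve `𝒴 = V(Z,u₁,u₂)` is permissible of the second kind -/

/-- `Σ_{i ∈ S} dᵢ = d₀ + d₁`. [cite: CossartPiltant2019, Example 3.1 (p. 32)] -/
theorem degIn_cp19Example31Centre (d : Fin 3 →₀ ℕ) : degIn cp19Example31Centre d = d 0 + d 1 := by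
  rw [degIn, cp19Example31Centre, Finset.sum_pair (show (0 : Fin 3) ≠ 1 by decide)]

/-- `ord_S(v u₂^p) = p`. [cite: CossartPiltant2019, Example 3.1 (p. 32)] -/
theorem degIn_centre_cp19Example31ExpA (p : ℕ) :
    degIn cp19Example31Centre (Finsupp.single 2 1 + Finsupp.single 1 p) = p := by
  have h := degIn_cp19Example31Centre (Finsupp.single 2 1 + Finsupp.single 1 p)
  rw [cp19Example31ExpA_zero, cp19Example31ExpA_one] at h
  omega

/-- `ord_S(u₁^{p+1}) = p + 1`. [cite: CossartPiltant2019, Example 3.1 (p. 32)] -/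
theorem degIn_centre_cp19Example31ExpB (p : ℕ) :
    degIn cp19Example31Centre (Finsupp.single 0 (p + 1)) = p + 1 := by
  have h := degIn_cp19Example31Centre (Finsupp.single 0 (p + 1))
  rw [cp19Example31ExpB_zero, cp19Example31ExpB_one] at h
  omega

/-- `ord_{C_S} F = p` ("`𝒴 ⊆ Sing_p 𝒳`"). [cite: CossartPiltant2019, Example 3.1 (p. 32)] -/
theorem cp19Example31_ordAlong (p : ℕ) :
    ordAlong cp19Example31Centre (cp19Example31 p : CState (Fin 3) K).F = p := by
  unfold ordAlong
  rw [cp19Example31_support, Finset.inf_insert, Finset.inf_singleton, degIn_centre_cp19Example31ExpA,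
    degIn_centre_cp19Example31ExpB]
  exact inf_eq_left.mpr (by exact_mod_cast Nat.le_succ p)

/-- `ε(y) = p`. [cite: CossartPiltant2019, Example 3.1 (p. 32) with Def. 2.9–2.10 (p. 15–16)] -/
theorem cp19Example31_epsilonAlong (p : ℕ) :
    epsilonAlong cp19Example31Centre (cp19Example31 p : CState (Fin 3) K) = p := by
  unfold epsilonAlong
  rw [Finset.sum_eq_zero (fun j _ => cp19Example31_bigH p j), tsub_zero, cp19Example31_ordAlong]

/-- Clause (i): `𝒴` is Hironaka-permissible w.r.t. `E` at `x`. [cite: CossartPiltant2019, Example 3.1 (p. 32)] -/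
theorem cp19Example31_isHironakaPermissible (p : ℕ) :
    IsHironakaPermissible p cp19Example31Centre (cp19Example31 p : CState (Fin 3) K) :=
  ⟨⟨0, by decide⟩, (cp19Example31_ordAlong p).ge⟩

/-- Clause (ii): `ε(y) + 1 = ε(x)`. [cite: CossartPiltant2019, Example 3.1 (p. 32)] -/
theorem cp19Example31_epsilonAlong_add_one (p : ℕ) :
    epsilonAlong cp19Example31Centre (cp19Example31 p : CState (Fin 3) K) + 1 =
      (cp19Example31 p : CState (Fin 3) K).epsilon := by
  rw [cp19Example31_epsilonAlong, cp19Example31_epsilon, Nat.cast_add_one]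

/-- `ε(y) = ω(x)`. [cite: CossartPiltant2019, Example 3.1 (p. 32)] -/
theorem cp19Example31_epsilonAlong_eq_omega (p : ℕ) :
    epsilonAlong cp19Example31Centre (cp19Example31 p : CState (Fin 3) K) =
      (cp19Example31 p : CState (Fin 3) K).omega := by
  rw [cp19Example31_epsilonAlong, cp19Example31_omega]

/-- Clause (iii): the monomial `v u₂^p` has least `S`-degree `p`, is linear in `v`, `v` is the only
variable off `S`, and `div(v) ⊄ E` ("`J̄ = ∂F_{p,Z_x,W}/∂v̄_x = U₂^p ≠ 0`").
[cite: CossartPiltant2019, Example 3.1 (p. 32)] -/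
theorem cp19Example31_hasTransverseLinear (p : ℕ) :
    HasTransverseLinear cp19Example31Centre (cp19Example31 p : CState (Fin 3) K) := by
  refine ⟨Finsupp.single 2 1 + Finsupp.single 1 p, ?_, ?_, 2, by decide,
    (show (2 : Fin 3) ∉ ({0} : Finset (Fin 3)) by decide), cp19Example31ExpA_two p, ?_⟩
  · rw [cp19Example31_support]; exact Finset.mem_insert_self _ _
  · rw [cp19Example31_ordAlong, degIn_centre_cp19Example31ExpA]
  · intro u hu hne
    have hu' : ∀ w : Fin 3, w ∉ cp19Example31Centre → w ≠ 2 → False := by decide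
    exact (hu' u hu hne).elim

/-- "Then `𝒴` is permissible of the second kind at every `x ∈ 𝒰`."
[cite: CossartPiltant2019, Example 3.1 (p. 32)] -/
theorem cp19Example31_isSecondKind (p : ℕ) :
    IsSecondKind p cp19Example31Centre (cp19Example31 p : CState (Fin 3) K) :=
  ⟨cp19Example31_isHironakaPermissible p, cp19Example31_epsilonAlong_add_one p,
    cp19Example31_hasTransverseLinear p⟩

/-- `𝒴` is not permissible of the first kind (`ε(y) = p ≠ p + 1 = ε(x)`).
[cite: CossartPiltant2019, Example 3.1 (p. 32)] -/
theorem cp19Example31_not_isFirstKind (p : ℕ) :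
    ¬ IsFirstKind p cp19Example31Centre (cp19Example31 p : CState (Fin 3) K) := by
  rintro ⟨-, h⟩
  rw [cp19Example31_epsilonAlong, cp19Example31_epsilon] at h
  have := ENat.coe_inj.mp h
  omega

/-- `𝒴` is a permissible centre at `x`. [cite: CossartPiltant2019, Example 3.1 (p. 32)] -/
theorem cp19Example31_isPermissibleCentre (p : ℕ) :
    IsPermissibleCentre p cp19Example31Centre (cp19Example31 p : CState (Fin 3) K) :=
  Or.inr (cp19Example31_isSecondKind p)

/-! ### 3. Blowing up `𝒴`: no point over `x` is again `p`-fold -/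

/-- `u₁`-chart: the chart law fixes `d_A` (`v u₂^p ↦ v u'₂^p`). [cite: CossartPiltant2019, Example 3.1 (p. 32)] -/
theorem chartExponent_zero_cp19Example31ExpA (p : ℕ) :
    chartExponent p cp19Example31Centre 0 (Finsupp.single 2 1 + Finsupp.single 1 p) =
      Finsupp.single 2 1 + Finsupp.single 1 p := by
  unfold chartExponent
  rw [degIn_centre_cp19Example31ExpA, Nat.sub_self]
  ext i
  rw [Finsupp.update_apply]
  split_ifs with h
  · rw [h, cp19Example31ExpA_zero]
  · rfl

/-- `u₁`-chart: `u₁^{p+1} ↦ u'₁`. [cite: CossartPiltant2019, Example 3.1 (p. 32)] -/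
theorem chartExponent_zero_cp19Example31ExpB (p : ℕ) :
    chartExponent p cp19Example31Centre 0 (Finsupp.single 0 (p + 1)) = Finsupp.single 0 1 := by
  unfold chartExponent
  rw [degIn_centre_cp19Example31ExpB, Nat.add_sub_cancel_left]
  ext i
  rw [Finsupp.update_apply]
  split_ifs with h
  · rw [h, Finsupp.single_eq_same]
  · rw [Finsupp.single_eq_of_ne h, Finsupp.single_eq_of_ne h]

/-- `u₂`-chart: `v u₂^p ↦ v`. [cite: CossartPiltant2019, Example 3.1 (p. 32)] -/
theorem chartExponent_one_cp19Example31ExpA (p : ℕ) :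
    chartExponent p cp19Example31Centre 1 (Finsupp.single 2 1 + Finsupp.single 1 p) =
      Finsupp.single 2 1 := by
  unfold chartExponent
  rw [degIn_centre_cp19Example31ExpA, Nat.sub_self]
  ext i
  rw [Finsupp.update_apply]
  split_ifs with h
  · rw [h, Finsupp.single_eq_of_ne (show (1 : Fin 3) ≠ 2 by decide)]
  · rw [Finsupp.add_apply, Finsupp.single_eq_of_ne (a := 1) h, add_zero]

/-- `u₂`-chart: `u₁^{p+1} ↦ u'₁^{p+1} u₂`. [cite: CossartPiltant2019, Example 3.1 (p. 32)] -/
theorem chartExponent_one_cp19Example31ExpB (p : ℕ) :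
    chartExponent p cp19Example31Centre 1 (Finsupp.single 0 (p + 1)) =
      Finsupp.single 0 (p + 1) + Finsupp.single 1 1 := by
  unfold chartExponent
  rw [degIn_centre_cp19Example31ExpB, Nat.add_sub_cancel_left]
  ext i
  rw [Finsupp.update_apply, Finsupp.add_apply]
  split_ifs with h
  · rw [h, Finsupp.single_eq_same, Finsupp.single_eq_of_ne (show (1 : Fin 3) ≠ 0 by decide), zero_add]
  · rw [Finsupp.single_eq_of_ne (a := 1) h, add_zero]

/-- `u₁`-chart: the chart transform of `F` is `v u'₂^p + u'₁`. [cite: CossartPiltant2019, Example 3.1 (p. 32)] -/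
theorem cp19Example31_chartTransform_zero (p : ℕ) :
    chartTransform p cp19Example31Centre 0 (cp19Example31 p : CState (Fin 3) K).F = X 2 * X 1 ^ p + X 0 := by
  have h2 : (X 2 : MvPolynomial (Fin 3) K) = monomial (Finsupp.single 2 1) 1 := rfl
  rw [cp19Example31_F, chartTransform_binomial' p cp19Example31Centre 0 (cp19Example31ExpA_ne_ExpB p),
    chartExponent_zero_cp19Example31ExpA, chartExponent_zero_cp19Example31ExpB, X_pow_eq_monomial, h2,
    monomial_mul, mul_one]
  rfl

/-- `u₂`-chart: the chart transform of `F` is `v + u'₁^{p+1} u₂`. [cite: CossartPiltant2019, Example 3.1 (p. 32)] -/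
theorem cp19Example31_chartTransform_one (p : ℕ) :
    chartTransform p cp19Example31Centre 1 (cp19Example31 p : CState (Fin 3) K).F =
      X 2 + X 0 ^ (p + 1) * X 1 := by
  have h1 : (X 1 : MvPolynomial (Fin 3) K) = monomial (Finsupp.single 1 1) 1 := rfl
  rw [cp19Example31_F, chartTransform_binomial' p cp19Example31Centre 1 (cp19Example31ExpA_ne_ExpB p),
    chartExponent_one_cp19Example31ExpA, chartExponent_one_cp19Example31ExpB, X_pow_eq_monomial, h1,
    monomial_mul, mul_one]
  rfl

/-- `u₁`-chart, point `b = (0, c, 0)` of the fibre over `x`: the transform is `v (u'₂ + c)^p + u'₁`.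
[cite: CossartPiltant2019, Example 3.1 (p. 32)] -/
theorem cp19Example31_pointTransform_zero (p : ℕ) (b : Fin 3 → K) (hb0 : b 0 = 0) (hb2 : b 2 = 0) :
    pointTransform p cp19Example31Centre 0 b (cp19Example31 p) = X 2 * (X 1 + C (b 1)) ^ p + X 0 := by
  unfold pointTransform PointBlowup.translate
  rw [cp19Example31_chartTransform_zero]
  simp only [map_add, map_mul, map_pow, aeval_X]
  rw [hb2, hb0, C_0, add_zero, add_zero]

/-- `u₂`-chart, point `b = (c, 0, 0)` of the fibre over `x`: the transform is `v + (u'₁ + c)^{p+1} u₂`.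
[cite: CossartPiltant2019, Example 3.1 (p. 32)] -/
theorem cp19Example31_pointTransform_one (p : ℕ) (b : Fin 3 → K) (hb1 : b 1 = 0) (hb2 : b 2 = 0) :
    pointTransform p cp19Example31Centre 1 b (cp19Example31 p) = X 2 + (X 0 + C (b 0)) ^ (p + 1) * X 1 := by
  unfold pointTransform PointBlowup.translate
  rw [cp19Example31_chartTransform_one]
  simp only [map_add, map_mul, map_pow, aeval_X]
  rw [hb1, hb2, C_0, add_zero, add_zero]

/-- `u₁`-chart: the coefficient of `u'₁` in the transform is `1`. [cite: CossartPiltant2019, Example 3.1 (p. 32)] -/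
theorem cp19Example31_coeff_pointTransform_zero (p : ℕ) (b : Fin 3 → K) (hb0 : b 0 = 0) (hb2 : b 2 = 0) :
    coeff (Finsupp.single 0 1) (pointTransform p cp19Example31Centre 0 b (cp19Example31 p)) = 1 := by
  have h2 : (2 : Fin 3) ∉ (Finsupp.single (0 : Fin 3) 1).support := by
    rw [Finsupp.support_single _ one_ne_zero]; decide
  rw [cp19Example31_pointTransform_zero p b hb0 hb2, coeff_add, coeff_X_mul', if_neg h2, coeff_X,
    if_pos rfl, zero_add]

/-- `u₂`-chart: the coefficient of `v` in the transform is `1`. [cite: CossartPiltant2019, Example 3.1 (p. 32)] -/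
theorem cp19Example31_coeff_pointTransform_one (p : ℕ) (b : Fin 3 → K) (hb1 : b 1 = 0) (hb2 : b 2 = 0) :
    coeff (Finsupp.single 2 1) (pointTransform p cp19Example31Centre 1 b (cp19Example31 p)) = 1 := by
  have h1 : (1 : Fin 3) ∉ (Finsupp.single (2 : Fin 3) 1).support := by
    rw [Finsupp.support_single _ one_ne_zero]; decide
  rw [cp19Example31_pointTransform_one p b hb1 hb2, coeff_add, coeff_X, if_pos rfl, coeff_mul_X',
    if_neg h1, add_zero]

/-- "`m(x') ≤ m(x) = p` in any case" — here strictly: in the `u₁`-chart NO point of the fibre over `x` is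
again `p`-fold (`u'₁` occurs with coefficient `1`, degree `1 < p`).
[cite: CossartPiltant2019, Example 3.1 (p. 32) with Thm. 3.6 (p. 35)] -/
theorem cp19Example31_not_isEquimultiplePoint_zero {p : ℕ} (hp : 1 < p) (b : Fin 3 → K) (hb0 : b 0 = 0)
    (hb2 : b 2 = 0) : ¬ IsEquimultiplePoint p cp19Example31Centre 0 b (cp19Example31 p) := by
  intro h
  have h1 := h (Finsupp.single 0 1) (Finsupp.single_ne_zero.mpr one_ne_zero)
    (by rw [Finsupp.degree_single]; exact hp)
  rw [cp19Example31_coeff_pointTransform_zero p b hb0 hb2] at h1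
  exact one_ne_zero h1

/-- In the `u₂`-chart NO point of the fibre over `x` is again `p`-fold (`v` occurs with coefficient `1`).
[cite: CossartPiltant2019, Example 3.1 (p. 32) with Thm. 3.6 (p. 35)] -/
theorem cp19Example31_not_isEquimultiplePoint_one {p : ℕ} (hp : 1 < p) (b : Fin 3 → K) (hb1 : b 1 = 0)
    (hb2 : b 2 = 0) : ¬ IsEquimultiplePoint p cp19Example31Centre 1 b (cp19Example31 p) := by
  intro h
  have h1 := h (Finsupp.single 2 1) (Finsupp.single_ne_zero.mpr one_ne_zero)
    (by rw [Finsupp.degree_single]; exact hp)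
  rw [cp19Example31_coeff_pointTransform_one p b hb1 hb2] at h1
  exact one_ne_zero h1

/-- No point of `π⁻¹(x)` is `p`-fold: for every chart `u_j`, `j ∈ S`, and every point `b` of the fibre
(`b_j = 0`, `b_v = 0`). [cite: CossartPiltant2019, Example 3.1 (p. 32) with Thm. 3.6 (p. 35)] -/
theorem cp19Example31_not_isEquimultiplePoint {p : ℕ} (hp : 1 < p) {j : Fin 3}
    (hj : j ∈ cp19Example31Centre) (b : Fin 3 → K) (hbj : b j = 0)
    (hoff : ∀ i, i ∉ cp19Example31Centre → b i = 0) :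
    ¬ IsEquimultiplePoint p cp19Example31Centre j b (cp19Example31 p) := by
  have hj' : j = 0 ∨ j = 1 := by simpa [cp19Example31Centre] using hj
  rcases hj' with rfl | rfl
  · exact cp19Example31_not_isEquimultiplePoint_zero hp b hbj (hoff 2 (by decide))
  · exact cp19Example31_not_isEquimultiplePoint_one hp b hbj (hoff 2 (by decide))

section Step

variable [DecidableEq K]

/-- `u₁`-chart: `u'₁` survives the cleaning of `p`-th powers (`p > 1`), with coefficient `1`.
[cite: CossartPiltant2019, Example 3.1 (p. 32)] -/
theorem cp19Example31_coeff_step_zero {p : ℕ} (hp : 1 < p) (b : Fin 3 → K) (hb0 : b 0 = 0)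
    (hb2 : b 2 = 0) :
    coeff (Finsupp.single 0 1) (step p cp19Example31Centre 0 b (cp19Example31 p)).F = 1 := by
  have hnot : ¬ IsPthPowerExponent p (Finsupp.single (0 : Fin 3) 1) := by
    rw [isPthPowerExponent_iff]
    intro h
    have h0 := h 0
    rw [Finsupp.single_eq_same] at h0
    have := Nat.dvd_one.mp h0
    omega
  show coeff _ (deletePthPowers p (pointTransform p cp19Example31Centre 0 b (cp19Example31 p))) = 1
  rw [coeff_deletePthPowers, if_neg hnot, cp19Example31_coeff_pointTransform_zero p b hb0 hb2]

/-- `u₂`-chart: `v` survives the cleaning of `p`-th powers (`p > 1`), with coefficient `1`.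
[cite: CossartPiltant2019, Example 3.1 (p. 32)] -/
theorem cp19Example31_coeff_step_one {p : ℕ} (hp : 1 < p) (b : Fin 3 → K) (hb1 : b 1 = 0)
    (hb2 : b 2 = 0) :
    coeff (Finsupp.single 2 1) (step p cp19Example31Centre 1 b (cp19Example31 p)).F = 1 := by
  have hnot : ¬ IsPthPowerExponent p (Finsupp.single (2 : Fin 3) 1) := by
    rw [isPthPowerExponent_iff]
    intro h
    have h2 := h 2
    rw [Finsupp.single_eq_same] at h2
    have := Nat.dvd_one.mp h2
    omega
  show coeff _ (deletePthPowers p (pointTransform p cp19Example31Centre 1 b (cp19Example31 p))) = 1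
  rw [coeff_deletePthPowers, if_neg hnot, cp19Example31_coeff_pointTransform_one p b hb1 hb2]

/-- `u₁`-chart: the cleaned transform at every point of the fibre has order `1`
("`h' = Z'^p + u'₁ + …`"). [cite: CossartPiltant2019, Example 3.1 (p. 32) with Thm. 3.6 (p. 35)] -/
theorem cp19Example31_ordZero_step_zero {p : ℕ} (hp : 1 < p) (b : Fin 3 → K) (hb0 : b 0 = 0)
    (hb2 : b 2 = 0) : ordZero (step p cp19Example31Centre 0 b (cp19Example31 p)).F = (1 : ℕ) :=
  ordZero_step_F_eq_one p cp19Example31Centre 0 b _ 0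
    (by rw [cp19Example31_coeff_step_zero hp b hb0 hb2]; exact one_ne_zero)

/-- `u₂`-chart: the cleaned transform at every point of the fibre has order `1`.
[cite: CossartPiltant2019, Example 3.1 (p. 32) with Thm. 3.6 (p. 35)] -/
theorem cp19Example31_ordZero_step_one {p : ℕ} (hp : 1 < p) (b : Fin 3 → K) (hb1 : b 1 = 0)
    (hb2 : b 2 = 0) : ordZero (step p cp19Example31Centre 1 b (cp19Example31 p)).F = (1 : ℕ) :=
  ordZero_step_F_eq_one p cp19Example31Centre 1 b _ 2
    (by rw [cp19Example31_coeff_step_one hp b hb1 hb2]; exact one_ne_zero)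

/-- `u₁`-chart: `ε(x') ≤ 1 < ε(x) = p + 1` at every point of the fibre.
[cite: CossartPiltant2019, Example 3.1 (p. 32) with Thm. 3.6 (p. 35)] -/
theorem cp19Example31_epsilon_step_zero_le {p : ℕ} (hp : 1 < p) (b : Fin 3 → K) (hb0 : b 0 = 0)
    (hb2 : b 2 = 0) : (step p cp19Example31Centre 0 b (cp19Example31 p)).epsilon ≤ 1 := by
  rw [CState.epsilon_eq, cp19Example31_ordZero_step_zero hp b hb0 hb2, Nat.cast_one]
  exact tsub_le_self

/-- `u₂`-chart: `ε(x') ≤ 1` at every point of the fibre.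
[cite: CossartPiltant2019, Example 3.1 (p. 32) with Thm. 3.6 (p. 35)] -/
theorem cp19Example31_epsilon_step_one_le {p : ℕ} (hp : 1 < p) (b : Fin 3 → K) (hb1 : b 1 = 0)
    (hb2 : b 2 = 0) : (step p cp19Example31Centre 1 b (cp19Example31 p)).epsilon ≤ 1 := by
  rw [CState.epsilon_eq, cp19Example31_ordZero_step_one hp b hb1 hb2, Nat.cast_one]
  exact tsub_le_self

/-- `ε` does not increase at any point of `π⁻¹(x)` (consistent with Thm. 3.6 (1): an increase of `ε`
would force `ε(y) = ε(x)`, i.e. a centre of the first kind). [cite: CossartPiltant2019, Example 3.1 (p. 32) with Thm. 3.6 (1) (p. 35)] -/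
theorem cp19Example31_not_epsilonIncreases {p : ℕ} (hp : 1 < p) {j : Fin 3}
    (hj : j ∈ cp19Example31Centre) (b : Fin 3 → K) (hbj : b j = 0)
    (hoff : ∀ i, i ∉ cp19Example31Centre → b i = 0) :
    ¬ EpsilonIncreases p cp19Example31Centre j b (cp19Example31 p) := by
  have hj' : j = 0 ∨ j = 1 := by simpa [cp19Example31Centre] using hj
  have hle1 : (1 : ℕ∞) ≤ (cp19Example31 p : CState (Fin 3) K).epsilon := by
    rw [cp19Example31_epsilon]; exact_mod_cast Nat.succ_le_succ (Nat.zero_le p)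
  unfold EpsilonIncreases
  rw [not_lt]
  rcases hj' with rfl | rfl
  · exact (cp19Example31_epsilon_step_zero_le hp b hbj (hoff 2 (by decide))).trans hle1
  · exact (cp19Example31_epsilon_step_one_le hp b hbj (hoff 2 (by decide))).trans hle1

/-- The row-wise test predicate `NoOmegaIncreaseAtCentre` (Thm. 3.6 read at one `C_S`-step) holds at
every `(j, b)` for Example 3.1: over `x` there is no `p`-fold point left, so the first component `m` of
`ι = (m, ω, κ)` drops. [cite: CossartPiltant2019, Example 3.1 (p. 32) with Thm. 3.6 (p. 35)] -/
theorem cp19Example31_noOmegaIncreaseAtCentre {p : ℕ} (hp : 1 < p) (j : Fin 3) (b : Fin 3 → K) :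
    NoOmegaIncreaseAtCentre p cp19Example31Centre j b (cp19Example31 p) :=
  fun hj hbj hoff _ heq _ _ _ => cp19Example31_not_isEquimultiplePoint hp hj b hbj hoff heq

/-- The row-wise test predicate `EpsilonIncreaseForcesFirstKindAt` (Thm. 3.6 (1) read at one
`C_S`-step) holds at every `(j, b)` for Example 3.1. [cite: CossartPiltant2019, Example 3.1 (p. 32) with Thm. 3.6 (1) (p. 35)] -/
theorem cp19Example31_epsilonIncreaseForcesFirstKindAt {p : ℕ} (hp : 1 < p) (j : Fin 3)
    (b : Fin 3 → K) : EpsilonIncreaseForcesFirstKindAt p cp19Example31Centre j b (cp19Example31 p) :=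
  fun hj hbj hoff _ heq _ _ _ => (cp19Example31_not_isEquimultiplePoint hp hj b hbj hoff heq).elim

end Step

/-! ### 4. Packaging -/

/-- **[CP19, Example 3.1] in the model.**  For `h = Z^p + v u₂^p + u₁^{p+1}`, `E = div(u₁)` (`p > 1`,
any field): the curve `𝒴 = V(Z,u₁,u₂)` is permissible of the second kind and not of the first kind at
`x`, `ω(x) = p > 0`, and after blowing up `𝒴` no point over `x` is `p`-fold.
[cite: CossartPiltant2019, Example 3.1 (p. 32)] -/
theorem cp19Example31_summary {p : ℕ} (hp : 1 < p) :
    IsSecondKind p cp19Example31Centre (cp19Example31 p : CState (Fin 3) K) ∧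
      ¬ IsFirstKind p cp19Example31Centre (cp19Example31 p : CState (Fin 3) K) ∧
      (cp19Example31 p : CState (Fin 3) K).omega = p ∧
      ∀ j ∈ cp19Example31Centre, ∀ b : Fin 3 → K, b j = 0 → (∀ i, i ∉ cp19Example31Centre → b i = 0) →
        ¬ IsEquimultiplePoint p cp19Example31Centre j b (cp19Example31 p) :=
  ⟨cp19Example31_isSecondKind p, cp19Example31_not_isFirstKind p, cp19Example31_omega p,
    fun _ hj b hbj hoff => cp19Example31_not_isEquimultiplePoint hp hj b hbj hoff⟩

end Example

end CentreBlowup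

end Literature.AlgebraicGeometry.Resolution

end
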